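import Summits.Ventures.PercRepro.RankLevelSetThroughMinor
import Summits.Ventures.PercRepro.RankLevelSetUpFour

/-! # RankLevelSetUpParallel — (↑) AT AN ELEMENT WITH A PARALLEL PARTNER IS THE PROFILE STEP `D_k ≤ D_{k+1}`
(night-1 g44; dossier §56.2)

If `b` and `b'` are parallel in `M` (`b' ∈ cl {b}`, `b ∈ cl {b'}`, `b ≠ b'`), every bi-independent set contains
EXACTLY ONE of them (both would make the set dependent, neither would make the complement dependent), and the swap
`W ↦ insert b' (W ∖ {b})` is a bijection between the bi-independent `k`-sets through `b` and those through `b'`. Hence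
`2·#{W ∈ D_k : b ∈ W} = D_k` and `2·#{Z ∈ D_{k+1} : b ∉ Z} = 2·#{Z ∈ D_{k+1} : b' ∈ Z} = D_{k+1}`, and (↑) at `b` and
level `k` is exactly the profile step `D_k ≤ D_{k+1}` (**`upAt_of_parallel`**). With Mono's step 5 (`biIndepCount_five_le_six`)
this is (↑)₅ at every element of a parallel pair on ≥ 12 elements (**`upAt_five_of_parallel`**), so the 12-element case
of the residue (P) of `upAt_five_of_nullity_five_of_residue` is needed only at elements without a parallel partner.
Every declaration has a docstring; imports: the cell's own modules and Mathlib only. Axioms: standard. -/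

namespace PercRepro

open Set Matroid

variable {α : Type} (M : Matroid α) [M.Finite]

/-! ## The swap of two parallel elements -/

omit [M.Finite] in
/-- **The swap keeps independence**: if `I` is independent, `b ∈ I`, `b' ∉ I` and `b ∈ cl {b'}`, then
`insert b' (I ∖ {b})` is independent. -/
theorem indep_swap_of_mem_closure {I : Set α} (hI : M.Indep I) {b b' : α} (hb : b ∈ I) (hb' : b' ∉ I)
    (hb'E : b' ∈ M.E) (h : b ∈ M.closure {b'}) : M.Indep (insert b' (I \ {b})) := by
  have hI' : M.Indep (I \ {b}) := hI.subset sdiff_subset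
  rw [hI'.insert_indep_iff_of_notMem (fun hmem => hb' hmem.1)]
  refine ⟨hb'E, fun hcl => ?_⟩
  have hsub : M.closure {b'} ⊆ M.closure (I \ {b}) :=
    M.closure_subset_closure_of_subset_closure (singleton_subset_iff.mpr hcl)
  exact hI.notMem_closure_sdiff_of_mem hb (hsub h)

omit [M.Finite] in
/-- **Two parallel elements are never both in an independent set.** -/
theorem not_both_mem_of_indep {I : Set α} (hI : M.Indep I) {b b' : α} (hne : b ≠ b') (h : b' ∈ M.closure {b})
    (hb : b ∈ I) (hb' : b' ∈ I) : False := by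
  have hsub : M.closure {b} ⊆ M.closure (I \ {b'}) :=
    M.closure_subset_closure (singleton_subset_iff.mpr ⟨hb, fun hb'' => hne hb''⟩)
  exact hI.notMem_closure_sdiff_of_mem hb' (hsub h)

omit [M.Finite] in
/-- **A bi-independent set contains exactly one of two parallel elements.** -/
theorem mem_iff_not_mem_of_biIndep {W : Set α} {k : ℕ} (hW : W ∈ biIndep M k) {b b' : α} (hne : b ≠ b')
    (hbE : b ∈ M.E) (hb'E : b' ∈ M.E) (h1 : b' ∈ M.closure {b}) (h2 : b ∈ M.closure {b'}) :
    b ∈ W ↔ b' ∉ W := by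
  obtain ⟨-, -, hind, hcind⟩ := hW
  constructor
  · intro hb hb'
    exact not_both_mem_of_indep M hind hne h1 hb hb'
  · intro hb'
    by_contra hb
    exact not_both_mem_of_indep M hcind hne.symm h2 ⟨hb'E, hb'⟩ ⟨hbE, hb⟩

omit [M.Finite] in
/-- **The complement of the swapped set is the swapped complement.** -/
theorem compl_swap {W : Set α} {b b' : α} (hbE : b ∈ M.E) (hb : b ∈ W) (hb' : b' ∉ W) :
    M.E \ insert b' (W \ {b}) = insert b ((M.E \ W) \ {b'}) := by
  ext x
  simp only [mem_sdiff, mem_insert_iff, mem_singleton_iff, not_or, not_and, not_not]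
  constructor
  · rintro ⟨hxE, hxb', hxW⟩
    by_cases hxb : x = b
    · exact Or.inl hxb
    · exact Or.inr ⟨⟨hxE, fun hxW' => hxb (hxW hxW')⟩, hxb'⟩
  · rintro (rfl | ⟨⟨hxE, hxW⟩, hxb'⟩)
    · exact ⟨hbE, fun h => hb' (h ▸ hb), fun _ => rfl⟩
    · exact ⟨hxE, hxb', fun hxW' => absurd hxW' hxW⟩

/-- **The swap sends bi-independent `k`-sets through `b` to bi-independent `k`-sets through `b'`.** -/
theorem swap_mem_biIndep {W : Set α} {k : ℕ} (hW : W ∈ biIndep M k) {b b' : α} (hne : b ≠ b') (hbE : b ∈ M.E)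
    (hb'E : b' ∈ M.E) (h1 : b' ∈ M.closure {b}) (h2 : b ∈ M.closure {b'}) (hb : b ∈ W) :
    insert b' (W \ {b}) ∈ biIndep M k ∧ b' ∈ insert b' (W \ {b}) := by
  have hb' : b' ∉ W := (mem_iff_not_mem_of_biIndep M hW hne hbE hb'E h1 h2).mp hb
  obtain ⟨hWE, hcard, hind, hcind⟩ := hW
  refine ⟨⟨?_, ?_, ?_, ?_⟩, mem_insert _ _⟩
  · exact insert_subset hb'E (sdiff_subset.trans hWE)
  · have hfin : (W \ {b}).Finite := (M.ground_finite.subset hWE).subset sdiff_subset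
    rw [ncard_insert_of_notMem (fun hmem => hb' hmem.1) hfin, ncard_sdiff_singleton_add_one hb
      (M.ground_finite.subset hWE), hcard]
  · exact indep_swap_of_mem_closure M hind hb hb' hb'E h2
  · rw [compl_swap M hbE hb hb']
    exact indep_swap_of_mem_closure M hcind ⟨hb'E, hb'⟩ (fun hmem => hmem.2 hb) hbE h1

omit [M.Finite] in
/-- **The swap is injective on sets through `b` avoiding `b'`.** -/
theorem swap_injOn {b b' : α} (hne : b ≠ b') :
    InjOn (fun W : Set α => insert b' (W \ {b})) {W | b ∈ W ∧ b' ∉ W} := by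
  rintro W ⟨hbW, hb'W⟩ W' ⟨hbW', hb'W'⟩ heq
  simp only at heq
  ext x
  by_cases hxb : x = b
  · subst hxb; exact ⟨fun _ => hbW', fun _ => hbW⟩
  · have : x ∈ insert b' (W \ {b}) ↔ x ∈ insert b' (W' \ {b}) := by rw [heq]
    simp only [mem_insert_iff, mem_sdiff, mem_singleton_iff, hxb, not_false_eq_true, and_true] at this
    constructor
    · intro hx
      rcases this.mp (Or.inr hx) with h | h
      · exact absurd (h ▸ hx) hb'W
      · exact h
    · intro hx
      rcases this.mpr (Or.inr hx) with h | h
      · exact absurd (h ▸ hx) hb'W'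
      · exact h

/-- **The through-`b` and through-`b'` families have the same size** for parallel `b, b'`. -/
theorem ncard_through_eq_of_parallel {b b' : α} (hne : b ≠ b') (hbE : b ∈ M.E) (hb'E : b' ∈ M.E)
    (h1 : b' ∈ M.closure {b}) (h2 : b ∈ M.closure {b'}) (k : ℕ) :
    {W ∈ biIndep M k | b ∈ W}.ncard = {W ∈ biIndep M k | b' ∈ W}.ncard := by
  apply le_antisymm
  · refine ncard_le_ncard_of_injOn (fun W => insert b' (W \ {b})) ?_ ?_
        ((biIndep_finite M k).subset (fun _ h => h.1))
    · rintro W ⟨hW, hb⟩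
      exact swap_mem_biIndep M hW hne hbE hb'E h1 h2 hb
    · refine (swap_injOn hne).mono ?_
      rintro W ⟨hW, hb⟩
      exact ⟨hb, (mem_iff_not_mem_of_biIndep M hW hne hbE hb'E h1 h2).mp hb⟩
  · refine ncard_le_ncard_of_injOn (fun W => insert b (W \ {b'})) ?_ ?_
        ((biIndep_finite M k).subset (fun _ h => h.1))
    · rintro W ⟨hW, hb'⟩
      exact swap_mem_biIndep M hW hne.symm hb'E hbE h2 h1 hb'
    · refine (swap_injOn hne.symm).mono ?_
      rintro W ⟨hW, hb'⟩
      exact ⟨hb', (mem_iff_not_mem_of_biIndep M hW hne.symm hb'E hbE h2 h1).mp hb'⟩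

/-- **Twice the through-`b` count is the whole level** for `b` with a parallel partner:
`2·#{W ∈ D_k : b ∈ W} = D_k`. -/
theorem two_mul_through_eq_of_parallel {b b' : α} (hne : b ≠ b') (hbE : b ∈ M.E) (hb'E : b' ∈ M.E)
    (h1 : b' ∈ M.closure {b}) (h2 : b ∈ M.closure {b'}) (k : ℕ) :
    2 * {W ∈ biIndep M k | b ∈ W}.ncard = biIndepCount M k := by
  have hsplit : biIndep M k = {W ∈ biIndep M k | b ∈ W} ∪ {W ∈ biIndep M k | b' ∈ W} := by
    ext W
    constructor
    · intro hW
      by_cases hb : b ∈ W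
      · exact Or.inl ⟨hW, hb⟩
      · exact Or.inr ⟨hW, by
          by_contra hb'
          exact hb ((mem_iff_not_mem_of_biIndep M hW hne hbE hb'E h1 h2).mpr hb')⟩
    · rintro (h | h) <;> exact h.1
  have hdisj : Disjoint {W ∈ biIndep M k | b ∈ W} {W ∈ biIndep M k | b' ∈ W} := by
    rw [Set.disjoint_left]
    rintro W ⟨hW, hb⟩ ⟨-, hb'⟩
    exact (mem_iff_not_mem_of_biIndep M hW hne hbE hb'E h1 h2).mp hb hb'
  have hU := congrArg Set.ncard hsplit
  unfold biIndepCount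
  rw [hU, ncard_union_eq hdisj ((biIndep_finite M k).subset (fun _ h => h.1))
    ((biIndep_finite M k).subset (fun _ h => h.1)), ← ncard_through_eq_of_parallel M hne hbE hb'E h1 h2 k]
  ring

omit [M.Finite] in
/-- **The avoid-`b` sets are the through-`b'` sets** at every level, for parallel `b, b'`. -/
theorem avoid_eq_through_of_parallel {b b' : α} (hne : b ≠ b') (hbE : b ∈ M.E) (hb'E : b' ∈ M.E)
    (h1 : b' ∈ M.closure {b}) (h2 : b ∈ M.closure {b'}) (k : ℕ) :
    {Z ∈ biIndep M k | b ∉ Z} = {Z ∈ biIndep M k | b' ∈ Z} := by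
  ext Z
  constructor
  · rintro ⟨hZ, hb⟩
    refine ⟨hZ, ?_⟩
    by_contra hb'
    exact hb ((mem_iff_not_mem_of_biIndep M hZ hne hbE hb'E h1 h2).mpr hb')
  · rintro ⟨hZ, hb'⟩
    exact ⟨hZ, fun hb => (mem_iff_not_mem_of_biIndep M hZ hne hbE hb'E h1 h2).mp hb hb'⟩

/-! ## (↑) at an element with a parallel partner -/

/-- **(↑) AT AN ELEMENT WITH A PARALLEL PARTNER IS THE PROFILE STEP**: if `b` has a parallel partner `b'` and
`D_k ≤ D_{k+1}`, then `BiIndepUpAt M b k` — `2·T_k(b) = D_k ≤ D_{k+1} = 2·V_{k+1}(b)`. -/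
theorem upAt_of_parallel {b b' : α} (hne : b ≠ b') (hbE : b ∈ M.E) (hb'E : b' ∈ M.E)
    (h1 : b' ∈ M.closure {b}) (h2 : b ∈ M.closure {b'}) {k : ℕ}
    (hD : biIndepCount M k ≤ biIndepCount M (k + 1)) : BiIndepUpAt M b k := by
  unfold BiIndepUpAt
  have hk := two_mul_through_eq_of_parallel M hne hbE hb'E h1 h2 k
  have hk1 := two_mul_through_eq_of_parallel M hne.symm hb'E hbE h2 h1 (k + 1)
  rw [avoid_eq_through_of_parallel M hne hbE hb'E h1 h2 (k + 1)]
  omega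

/-- **(↑)₅ at every element of a parallel pair on ≥ 12 elements** (Mono's step 5). -/
theorem upAt_five_of_parallel {b b' : α} (hne : b ≠ b') (hbE : b ∈ M.E) (hb'E : b' ∈ M.E)
    (h1 : b' ∈ M.closure {b}) (h2 : b ∈ M.closure {b'}) (hn : 12 ≤ M.E.ncard) : BiIndepUpAt M b 5 :=
  upAt_of_parallel M hne hbE hb'E h1 h2 (biIndepCount_five_le_six M hn)

end PercRepro
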